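import Mathlib
import Summits.Ventures.PercRepro2.Defs
import Summits.Ventures.PercRepro2.Harris
import Summits.Ventures.PercRepro2.CoinDefs
import Summits.Ventures.PercRepro2.CoinLsmCoreDefs
import Summits.Ventures.PercRepro2.CoinLsmCoreU
import Summits.Ventures.PercRepro2.CoinSquareCoreDefs

/-!
# The eight core level probabilities of the undirected square (blind cell PercRepro2, night-2
g8; proofs/NIGHT2-DARC.md §31.5)

From `SquareCore.prob_level` (a sum over the `16` configurations of the four pair-coins
`α = c₁, β = c₂, γ = c₃, δ = c₄`): `ν(∅) = (1−α)(1−β)`, `ν({p}) = α(1−β)(1−γ)`,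
`ν({q}) = (1−α)β(1−δ)`, `ν({p,q}) = αβ(1−γ)(1−δ)`, `ν({a}) = 0`, `ν({p,a}) = α(1−β)γ(1−δ)`,
`ν({q,a}) = (1−α)β(1−γ)δ`, `ν({p,q,a}) = αβ(γ + δ − γδ) + α(1−β)γδ + (1−α)βγδ`.
-/

namespace Summit.Ventures.PercRepro2.Coin

open Classical

section SquareLevelValues

variable {V : Type*} {E : Type*} [DecidableEq V] [Fintype E] [DecidableEq E]
  {R : Type*} [Field R]
  {arcs : E → Finset (V × V)} {s p q a : V} {c₁ c₂ c₃ c₄ : E}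

/-- `ν(∅) = (1 − α)(1 − β)`. -/
theorem SquareCore.nu_empty (h : SquareCore arcs s p q a c₁ c₂ c₃ c₄) (pr : E → R)
    (h12 : c₁ ≠ c₂) (h13 : c₁ ≠ c₃) (h14 : c₁ ≠ c₄) (h23 : c₂ ≠ c₃) (h24 : c₂ ≠ c₄) (h34 : c₃ ≠ c₄) :
    prob pr (coreLevel arcs s {p, q, a} ∅) = (1 - pr c₁) * (1 - pr c₂) := by
  rw [h.prob_level pr h12 h13 h14 h23 h24 h34]
  simp [Fintype.sum_prod_type]
  ring

/-- `ν({p}) = α(1 − β)(1 − γ)`. -/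
theorem SquareCore.nu_p (h : SquareCore arcs s p q a c₁ c₂ c₃ c₄) (pr : E → R)
    (h12 : c₁ ≠ c₂) (h13 : c₁ ≠ c₃) (h14 : c₁ ≠ c₄) (h23 : c₂ ≠ c₃) (h24 : c₂ ≠ c₄) (h34 : c₃ ≠ c₄) :
    prob pr (coreLevel arcs s {p, q, a} {p}) = pr c₁ * (1 - pr c₂) * (1 - pr c₃) := by
  rw [h.prob_level pr h12 h13 h14 h23 h24 h34]
  simp [Fintype.sum_prod_type, h.pq.symm, h.pa.symm]
  ring

/-- `ν({q}) = (1 − α)β(1 − δ)`. -/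
theorem SquareCore.nu_q (h : SquareCore arcs s p q a c₁ c₂ c₃ c₄) (pr : E → R)
    (h12 : c₁ ≠ c₂) (h13 : c₁ ≠ c₃) (h14 : c₁ ≠ c₄) (h23 : c₂ ≠ c₃) (h24 : c₂ ≠ c₄) (h34 : c₃ ≠ c₄) :
    prob pr (coreLevel arcs s {p, q, a} {q}) = (1 - pr c₁) * pr c₂ * (1 - pr c₄) := by
  rw [h.prob_level pr h12 h13 h14 h23 h24 h34]
  simp [Fintype.sum_prod_type, h.pq, h.qa.symm]
  ring

/-- `ν({p, q}) = αβ(1 − γ)(1 − δ)`. -/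
theorem SquareCore.nu_pq (h : SquareCore arcs s p q a c₁ c₂ c₃ c₄) (pr : E → R)
    (h12 : c₁ ≠ c₂) (h13 : c₁ ≠ c₃) (h14 : c₁ ≠ c₄) (h23 : c₂ ≠ c₃) (h24 : c₂ ≠ c₄) (h34 : c₃ ≠ c₄) :
    prob pr (coreLevel arcs s {p, q, a} {p, q}) = pr c₁ * pr c₂ * (1 - pr c₃) * (1 - pr c₄) := by
  rw [h.prob_level pr h12 h13 h14 h23 h24 h34]
  simp [Fintype.sum_prod_type, h.pa.symm, h.qa.symm]

/-- `ν({a}) = 0`: the vertex `a` is never reached alone. -/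
theorem SquareCore.nu_a (h : SquareCore arcs s p q a c₁ c₂ c₃ c₄) (pr : E → R)
    (h12 : c₁ ≠ c₂) (h13 : c₁ ≠ c₃) (h14 : c₁ ≠ c₄) (h23 : c₂ ≠ c₃) (h24 : c₂ ≠ c₄) (h34 : c₃ ≠ c₄) :
    prob pr (coreLevel arcs s {p, q, a} {a}) = 0 := by
  rw [h.prob_level pr h12 h13 h14 h23 h24 h34]
  simp [Fintype.sum_prod_type, h.pa, h.qa]

/-- `ν({p, a}) = α(1 − β)γ(1 − δ)`. -/
theorem SquareCore.nu_pa (h : SquareCore arcs s p q a c₁ c₂ c₃ c₄) (pr : E → R)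
    (h12 : c₁ ≠ c₂) (h13 : c₁ ≠ c₃) (h14 : c₁ ≠ c₄) (h23 : c₂ ≠ c₃) (h24 : c₂ ≠ c₄) (h34 : c₃ ≠ c₄) :
    prob pr (coreLevel arcs s {p, q, a} {p, a}) = pr c₁ * (1 - pr c₂) * pr c₃ * (1 - pr c₄) := by
  rw [h.prob_level pr h12 h13 h14 h23 h24 h34]
  simp [Fintype.sum_prod_type, h.pq.symm, h.qa]

/-- `ν({q, a}) = (1 − α)β(1 − γ)δ`. -/
theorem SquareCore.nu_qa (h : SquareCore arcs s p q a c₁ c₂ c₃ c₄) (pr : E → R)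
    (h12 : c₁ ≠ c₂) (h13 : c₁ ≠ c₃) (h14 : c₁ ≠ c₄) (h23 : c₂ ≠ c₃) (h24 : c₂ ≠ c₄) (h34 : c₃ ≠ c₄) :
    prob pr (coreLevel arcs s {p, q, a} {q, a}) = (1 - pr c₁) * pr c₂ * (1 - pr c₃) * pr c₄ := by
  rw [h.prob_level pr h12 h13 h14 h23 h24 h34]
  simp [Fintype.sum_prod_type, h.pq, h.pa]

/-- `ν({p, q, a}) = αβ(γ + δ − γδ) + α(1 − β)γδ + (1 − α)βγδ`. -/
theorem SquareCore.nu_pqa (h : SquareCore arcs s p q a c₁ c₂ c₃ c₄) (pr : E → R)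
    (h12 : c₁ ≠ c₂) (h13 : c₁ ≠ c₃) (h14 : c₁ ≠ c₄) (h23 : c₂ ≠ c₃) (h24 : c₂ ≠ c₄) (h34 : c₃ ≠ c₄) :
    prob pr (coreLevel arcs s {p, q, a} {p, q, a}) =
      pr c₁ * pr c₂ * (pr c₃ + pr c₄ - pr c₃ * pr c₄) + pr c₁ * (1 - pr c₂) * pr c₃ * pr c₄
        + (1 - pr c₁) * pr c₂ * pr c₃ * pr c₄ := by
  rw [h.prob_level pr h12 h13 h14 h23 h24 h34]
  simp [Fintype.sum_prod_type]
  ring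

end SquareLevelValues

end Summit.Ventures.PercRepro2.Coin
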